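import Literature.NumberTheory.Transcendental.KZVolumeConjectureProofs
import Mathlib.Topology.Bornology.Basic

/-!
# Route ValuedFieldSpecialisation — crux `ParametricLifting` (stmt-KontsevichZagierPeriods-3498):
the bounded-volume normal form of a dimension level

Helper (`--supports`) for item stmt-KontsevichZagierPeriods-3498, line `registered` (graded reshape),
lead c8 "graded strata comparison". The reshaped skeleton proves the kernel conjecture level by level,
level `E + 1` being the subgroup `AddSubgroup.closure {y | ∃ n (r : KZ.IntegralRep n), n < E + 1 ∧ y = KZ.of r}`
of `KZ.FormalRep` generated by the classes of representations of dimension `≤ E`. This file proves the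
NORMAL FORM feeding the comparison with the dimension strata of the other routes
(`stub_volumeNormalForm_level`): every element `x` of level `E + 1` is congruent modulo
`KZ.relations` (the subgroup generated by the four moves of the Kontsevich–Zagier calculus) to a
difference `[A] − [B]` of two representations of dimension `E + 1` with BOUNDED domain and integrand
`1` on the domain ("bounded volumes").

Proof: `AddSubgroup.closure_induction`. A generator `[r]`, `dim r = n ≤ E`, is first raised to
dimension `E` by unit slabs (rule (3), `KZ.IntegralRep.exists_equivalent_of_le`) and then split as
`[A] − [B]` one dimension up by Viu-Sos' bounded reduction (`KZ.exists_sub_isBounded`: sign split by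
rule (1), regions under the graphs by rule (3), compactification by rule (2)); `0 ≡ [∅] − [∅]`; sums
merge the positive parts and the negative parts separately inside `ℝ^{E+1}` (`KZ.exists_merge₂`,
disjoint translates, rules (1)–(2)); negation swaps `A` and `B`. Pure move bookkeeping, no
transcendence input; only proved tree API is used. (Same argument as the `m ≤ d`-indexed
`LiouvilleUnfolding.NilradicalCut.exists_isBounded_sub_mem_relations_of_mem_closure_dim_le`, restated
on the `n < E + 1` levels of this skeleton with the light import `KZVolumeConjectureProofs`.)

Sources: M. Kontsevich, D. Zagier, *Periods* (2001), §1.2, rules (1)–(3); J. Viu-Sos,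
*A semi-canonical reduction for periods of Kontsevich–Zagier*, Int. J. Number Theory 17 (2021),
Cor. 2.3 (every period is a difference of the volumes of two compact semialgebraic sets).
-/

noncomputable section

namespace Summit.KontsevichZagierPeriods.ValuedFieldSpecialisation

open Literature.NumberTheory.Transcendental

/-- **Bounded-volume normal form of a dimension level.** Every element of
`AddSubgroup.closure {[r] | dim r < E + 1}` is congruent modulo `KZ.relations` to `[A] − [B]` with
`A B : KZ.IntegralRep (E + 1)` of bounded domain and integrand `1` on the domain: generators by unit
slabs (`KZ.IntegralRep.exists_equivalent_of_le`) and Viu-Sos' bounded reduction one dimension up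
(`KZ.exists_sub_isBounded`), `0 ≡ [∅] − [∅]`, sums by merging the two positive and the two negative
parts (`KZ.exists_merge₂`), negation by swapping. [Kontsevich–Zagier 2001, §1.2, rules (1)–(3);
Viu-Sos 2021, Cor. 2.3] [cite: ViuSos2021, Cor. 2.3] -/
theorem stub_volumeNormalForm_level : ∀ (E : ℕ) (x : KZ.FormalRep), x ∈ AddSubgroup.closure {y : KZ.FormalRep | ∃ (n : ℕ) (r : KZ.IntegralRep n), n < E + 1 ∧ y = KZ.of r} → ∃ A B : KZ.IntegralRep (E + 1), Bornology.IsBounded A.domain ∧ Bornology.IsBounded B.domain ∧ (∀ z ∈ A.domain, A.integrand z = 1) ∧ (∀ z ∈ B.domain, B.integrand z = 1) ∧ x - (KZ.of A - KZ.of B) ∈ KZ.relations := by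
  intro E x hx
  induction hx using AddSubgroup.closure_induction with
  | mem y hy =>
    -- a generator `[r]`, `dim r = n ≤ E`: raise to dimension `E`, then Viu-Sos one dimension up
    obtain ⟨n, r, hn, rfl⟩ := hy
    obtain ⟨R, hR⟩ := r.exists_equivalent_of_le (N := E) (Nat.le_of_lt_succ hn)
    obtain ⟨A, B, hAb, hBb, hA1, hB1, eR⟩ := KZ.exists_sub_isBounded R
    refine ⟨A, B, hAb, hBb, hA1, hB1, ?_⟩
    have : KZ.of r - (KZ.of A - KZ.of B) = (KZ.of r - KZ.of R) + (KZ.of R - (KZ.of A - KZ.of B)) := by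
      abel
    rw [this]
    exact KZ.relations.add_mem hR eR
  | zero =>
    -- `0 ≡ [∅] − [∅]`
    refine ⟨KZ.IntegralRep.empty (E + 1), KZ.IntegralRep.empty (E + 1), by simp, by simp, by simp,
      by simp, ?_⟩
    simp
  | add x y _ _ ihx ihy =>
    -- merge the positive parts and the negative parts separately
    obtain ⟨A₁, B₁, hA₁b, hB₁b, hA₁1, hB₁1, e₁⟩ := ihx
    obtain ⟨A₂, B₂, hA₂b, hB₂b, hA₂1, hB₂1, e₂⟩ := ihy
    obtain ⟨A, hAb, hA1, eA⟩ := KZ.exists_merge₂ A₁ A₂ hA₁b hA₂b hA₁1 hA₂1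
    obtain ⟨B, hBb, hB1, eB⟩ := KZ.exists_merge₂ B₁ B₂ hB₁b hB₂b hB₁1 hB₂1
    refine ⟨A, B, hAb, hBb, hA1, hB1, ?_⟩
    have : x + y - (KZ.of A - KZ.of B) = (x - (KZ.of A₁ - KZ.of B₁)) + (y - (KZ.of A₂ - KZ.of B₂)) +
        (KZ.of A₁ + KZ.of A₂ - KZ.of A) - (KZ.of B₁ + KZ.of B₂ - KZ.of B) := by
      abel
    rw [this]
    exact KZ.relations.sub_mem (KZ.relations.add_mem (KZ.relations.add_mem e₁ e₂) eA) eB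
  | neg x _ ih =>
    -- swap the two volumes
    obtain ⟨A, B, hAb, hBb, hA1, hB1, e⟩ := ih
    refine ⟨B, A, hBb, hAb, hB1, hA1, ?_⟩
    have : -x - (KZ.of B - KZ.of A) = -(x - (KZ.of A - KZ.of B)) := by abel
    rw [this]
    exact KZ.relations.neg_mem e

end Summit.KontsevichZagierPeriods.ValuedFieldSpecialisation

end
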